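import Literature.AlgebraicGeometry.Resolution.QuadraticTransformsRegular
import HarnessLib

/-!
# The infinite sequence of quadratic transforms along a valuation
# (crux `IndSmooth.ValuativeSmoothing`, line `birth`, stub `stub_quadraticSequence`)

Stub `stub_quadraticSequence` of the skeleton `Lines/birth.lean` (lead reshape r5, family 4:
"`O` dominates a two-dimensional regular local ring of `K`") for crux
stmt-ResolutionOfSingularities-16087. It supplies the INPUT of Abhyankar's union lemma
(`AbhyankarQuadraticUnion_holds`, Abhyankar 1956, Lemma 12): for a proper valuation ring
`O ≠ K` of a field `K` dominating a regular local ring `R₀` of `K` (local, with quotient field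
`K`), the infinite sequence `R₀ = R 0 → R 1 → R 2 → ⋯` of quadratic transforms ALONG `O`
(`IsQuadraticTransformAlong O (R i) (R (i + 1))`: the local blowing up of `R i` along its maximal
ideal with respect to `O`) exists.

Proof: iterate one step. If `S ⊆ O` is a regular local subring containing `R₀`, its maximal
ideal is finitely generated (`S` is Noetherian) and nonzero — were it zero, every nonzero element
of `S` would be a unit of `S`, so every `z = a / b ∈ K` (`a, b ∈ R₀ ⊆ S`, `b ≠ 0`) would lie in
`S ⊆ O`, forcing `O = K`; hence the local blowing up of `S` along `maximalIdeal S` with respect to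
`O` exists (`exists_isLocalBlowupAlong`), and its target is again a regular local subring of `O`
containing `R₀` (`IsQuadraticTransformAlong.isRegularLocalRing_of_isRegularLocalRing`, `.le`,
`.target_le`). Choosing one such target for every admissible `S` and iterating from `R₀` gives the
sequence.
-/

-- single-problem summit: the doubled namespace component is forced
set_option linter.dupNamespace false

namespace Summit.ResolutionOfSingularities.ResolutionOfSingularities.Theorems.ValuativeSmoothing

open IsLocalRing Literature.AlgebraicGeometry.Resolution

/-- **A local ring of `K` inside a proper valuation ring is not a field.** If `O ≠ K` is a
valuation ring of `K`, `R₀ ⊆ S ⊆ O` are subrings, every element of `K` is a quotient of elements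
of `R₀`, and `S` is local, then `maximalIdeal S ≠ ⊥`: otherwise every nonzero `b ∈ S` is a unit
of `S`, so `a / b ∈ S ⊆ O` for all `a, b ∈ R₀`, `b ≠ 0`, i.e. `O = K`. [folklore] -/
theorem maximalIdeal_ne_bot_of_le_valuationSubring {K : Type} [Field K] (O : ValuationSubring K)
    (hO : O ≠ ⊤) {R₀ S : Subring K} [IsLocalRing S] (hR₀S : R₀ ≤ S) (hSO : S ≤ O.toSubring)
    (hfrac : ∀ z : K, ∃ a ∈ R₀, ∃ b ∈ R₀, b ≠ 0 ∧ z = a / b) : maximalIdeal S ≠ ⊥ := by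
  intro hbot
  apply hO
  refine ValuationSubring.ext _ _ fun z => ⟨fun _ => ValuationSubring.mem_top z, fun _ => ?_⟩
  obtain ⟨a, ha, b, hb, hb0, rfl⟩ := hfrac z
  -- `b` is a unit of `S`: it is nonzero and the maximal ideal of `S` is zero
  have hbu : IsUnit (⟨b, hR₀S hb⟩ : S) := by
    by_contra hnu
    have hmem : (⟨b, hR₀S hb⟩ : S) ∈ maximalIdeal S := (mem_maximalIdeal _).mpr hnu
    rw [hbot, Ideal.mem_bot] at hmem
    exact hb0 (congrArg Subtype.val hmem)
  have hbinv : b⁻¹ ∈ S := ((isUnit_subring_iff_inv_mem _).mp hbu).2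
  change a / b ∈ O.toSubring
  rw [div_eq_mul_inv]
  exact hSO (S.mul_mem (hR₀S ha) hbinv)

/-- **One quadratic transform along `O` exists** from every regular local subring `S ⊆ O`
containing a subring `R₀` with quotient field `K`, provided `O ≠ K`: the maximal ideal of `S` is
finitely generated (Noetherian) and nonzero (`maximalIdeal_ne_bot_of_le_valuationSubring`), so
the local blowing up of `S` along it with respect to `O` exists (`exists_isLocalBlowupAlong`).
[cite: NovacoskiSpivakovsky2014, Def. 2.11] -/
theorem exists_isQuadraticTransformAlong_of_isRegularLocalRing {K : Type} [Field K]
    (O : ValuationSubring K) (hO : O ≠ ⊤) {R₀ S : Subring K} (hS : IsRegularLocalRing S)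
    (hR₀S : R₀ ≤ S) (hSO : S ≤ O.toSubring)
    (hfrac : ∀ z : K, ∃ a ∈ R₀, ∃ b ∈ R₀, b ≠ 0 ∧ z = a / b) :
    ∃ S' : Subring K, IsQuadraticTransformAlong O S S' := by
  have hfg : (maximalIdeal S).FG := IsNoetherian.noetherian _
  have hne : maximalIdeal S ≠ ⊥ := maximalIdeal_ne_bot_of_le_valuationSubring O hO hR₀S hSO hfrac
  obtain ⟨S', H⟩ := exists_isLocalBlowupAlong hSO (maximalIdeal S) hfg hne
  exact ⟨S', inferInstance, H⟩

/-- **Stub `stub_quadraticSequence` (line `birth`, crux `IndSmooth.ValuativeSmoothing`; r5-S1).**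
For a valuation ring `O ≠ K` of the field `K` dominating a regular local ring `R₀` of `K` (local,
with quotient field `K`), the infinite sequence `R₀ = R 0 → R 1 → ⋯` of quadratic transforms along
`O` exists: each `R (i + 1)` is the local blowing up of `R i` along its maximal ideal with respect
to `O`. The members stay regular local (`IsQuadraticTransformAlong.isRegularLocalRing_of_isRegularLocalRing`),
inside `O` (`.target_le`) and above `R₀` (`.le`), so one step
(`exists_isQuadraticTransformAlong_of_isRegularLocalRing`) can be iterated.
[cite: Abhyankar1956Valuations, Lemma 12] -/
theorem stub_quadraticSequence {K : Type} [Field K] (O : ValuationSubring K) (hO : O ≠ ⊤)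
    (R₀ : Subring K) (hreg : IsRegularLocalRing R₀) (hof : IsLocalRingOf R₀)
    (hdom : SubringDominates R₀ O.toSubring) :
    ∃ R : ℕ → Subring K, R 0 = R₀ ∧ ∀ i, IsQuadraticTransformAlong O (R i) (R (i + 1)) := by
  classical
  -- the invariant carried along the sequence
  let P : Subring K → Prop := fun S => R₀ ≤ S ∧ S ≤ O.toSubring ∧ IsRegularLocalRing S
  have hP0 : P R₀ := ⟨le_rfl, hdom.1, hreg⟩
  have hstep : ∀ S, P S → ∃ S', IsQuadraticTransformAlong O S S' ∧ P S' := by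
    rintro S ⟨hR₀S, hSO, hS⟩
    obtain ⟨S', h'⟩ :=
      exists_isQuadraticTransformAlong_of_isRegularLocalRing O hO hS hR₀S hSO hof.2
    exact ⟨S', h', hR₀S.trans h'.le, h'.target_le, h'.isRegularLocalRing_of_isRegularLocalRing hS⟩
  choose! f hf using hstep
  -- iterate `f` from `R₀`
  let R : ℕ → Subring K := fun n => Nat.rec R₀ (fun _ S => f S) n
  have hR : ∀ n, P (R n) := by
    intro n
    induction n with
    | zero => exact hP0
    | succ n ih => exact (hf (R n) ih).2
  exact ⟨R, rfl, fun i => (hf (R i) (hR i)).1⟩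

end Summit.ResolutionOfSingularities.ResolutionOfSingularities.Theorems.ValuativeSmoothing
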